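import Literature.NumberTheory.DiophantineApproximation.FactorialRatioRate
import Mathlib.Analysis.SpecialFunctions.Stirling
import Mathlib.Analysis.Asymptotics.Lemmas
import HarnessLib

/-!
# Exponential rate of `m^(2wn) (wn)! ((mwn)!)^w / (((mw+1)n+1)!)^w`

Topic `Literature/NumberTheory/DiophantineApproximation`. Everything in this file is PROVED.

For a shift `m ≥ 1` and a weight `w ≥ 1`, the quantity
`K_n = m^(2wn) (wn)! ((mwn)!)^w / (((mw+1)n+1)!)^w` is the first non-vanishing coefficient of the
`m`-shift type-I Hermite–Padé forms used for the linear independence of polylogarithmic values;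
its exponential rate enters the threshold of that result. We prove the sharp rate: for every
`ε > 0`,

  `exp (-(w ((mw+1) log ((mw+1)/(mw)) - log m) + ε) n) ≤ K_n`  for all large `n`

(`eventually_exp_le_kernelM_self`), i.e. the rate is
`κ_m(w) = w ((mw+1) log ((mw+1)/(mw)) - log m)`; it may be negative
(`κ_2(2) = 10 log (5/4) - 2 log 2 = 0.845…`, `κ_4(2) = 18 log (9/8) - 2 log 4 = -0.652…`). The
case `m = 2` (constant `4^(wn)`) is `eventually_exp_le_kernelH_self` in
`PolylogTwoPointLeadingRate`, and `m = 1` gives the rate `w (w+1) log ((w+1)/w)` of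
`FactorialPowerRate`.

Proof: Stirling's formula via Mathlib, exactly as in the case `m = 2`. The lower bound
`a log a - a ≤ log a!` (`a ≥ 1`) is `Stirling.le_log_factorial_stirling` (dropping non-negative
terms), applied to `a = wn` and `a = mwn`; the upper bound `log b! ≤ b log b - b + (log b)/2 + 1`
for `b = (mw+1)n + 1` is `log_factorial_succ_le`. The linear terms cancel
(`wn + mw²n = w((mw+1)n+1) - w`), leaving
`log K_n ≥ 2wn log m + wn log (wn) + mw²n log (mwn) - w(mw+1) n log b - (3w/2) log b`; then
`log b - log (mwn) - log ((mw+1)/(mw)) = log (1 + 1/((mw+1)n)) ≤ 1/((mw+1)n)` and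
`log (wn) = log (mwn) - log m` bound this below by `-κ_m(w) n - w - (3w/2) log b`
(the `n log (mwn)` terms cancel: `w + mw² = w(mw+1)`); finally `w + 2w log ((mw+1)n+1) ≤ ε n`
eventually (`log = o(id)`).

What is NOT here: the matching upper bound (the rate is exact), and any effective threshold.
-/

namespace Literature.NumberTheory.DiophantineApproximation

open _root_.Filter _root_.Topology _root_.Asymptotics Real

/-- **Exponential rate of `m^(2wn) (wn)! ((mwn)!)^w / (((mw+1)n+1)!)^w` (sharp form, every
shift and weight).** For every shift `m ≥ 1`, every weight `w ≥ 1` and every `ε > 0`, eventually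
in `n`,
`exp (-(w ((mw+1) log ((mw+1)/(mw)) - log m) + ε) n) ≤ m^(2wn) (wn)! ((mwn)!)^w / (((mw+1)n+1)!)^w`.
This is the rate of the leading coefficient of the `m`-shift Hermite–Padé forms for
polylogarithms; it follows from Stirling's formula (`Stirling.le_log_factorial_stirling`,
`log_factorial_succ_le`) and `log x = o(x)`. [folklore] -/
theorem eventually_exp_le_kernelM_self (m w : ℕ) (hm : 1 ≤ m) (hw : 1 ≤ w) {ε : ℝ} (hε : 0 < ε) :
    ∀ᶠ n : ℕ in Filter.atTop,
      Real.exp (-(((w : ℝ) * (((m : ℝ) * w + 1) * Real.log (((m : ℝ) * w + 1) / ((m : ℝ) * w))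
          - Real.log m) + ε) * n)) ≤
        (m : ℝ) ^ (2 * (w * n)) * ((w * n).factorial : ℝ) * (((m * w * n).factorial : ℝ) ^ w) /
          ((((m * w + 1) * n + 1).factorial : ℝ) ^ w) := by
  have hm0 : (0 : ℝ) < m := Nat.cast_pos.mpr (by omega)
  have hm1 : (1 : ℝ) ≤ m := by exact_mod_cast hm
  have hw0 : (0 : ℝ) < w := Nat.cast_pos.mpr (by omega)
  have hw1 : (1 : ℝ) ≤ w := by exact_mod_cast hw
  -- (1) the sub-linear loss `w + 2w log ((mw+1)n+1)` is eventually at most `ε n`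
  have hlog : ∀ᶠ n : ℕ in atTop,
      (w : ℝ) + 2 * w * Real.log (((m : ℝ) * w + 1) * (n : ℝ) + 1) ≤ ε * n := by
    have h1 : ∀ᶠ n : ℕ in atTop, ‖Real.log (n : ℝ)‖ ≤ ε / (4 * w) * ‖id (n : ℝ)‖ :=
      Real.isLittleO_log_id_atTop.natCast_atTop.bound (by positivity)
    have h2 : ∀ᶠ n : ℕ in atTop, (2 * w + 4 * w * Real.log ((m : ℝ) * w + 2)) / ε ≤ (n : ℝ) :=
      tendsto_natCast_atTop_atTop.eventually_ge_atTop _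
    filter_upwards [h1, h2, eventually_ge_atTop 1] with n hn1 hn2 hn3
    have hn : (1 : ℝ) ≤ n := by exact_mod_cast hn3
    rw [id, Real.norm_eq_abs, Real.norm_eq_abs, abs_of_nonneg (Real.log_nonneg hn),
      abs_of_nonneg (zero_le_one.trans hn)] at hn1
    have h3 : 2 * w * Real.log n ≤ ε / 2 * n := by
      have h := mul_le_mul_of_nonneg_left hn1 (by positivity : (0 : ℝ) ≤ 2 * w)
      have e : 2 * (w : ℝ) * (ε / (4 * w) * n) = ε / 2 * n := by
        field_simp
        ring
      linarith
    have hmw : (0 : ℝ) ≤ (m : ℝ) * w * n := by positivity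
    have h4 : Real.log (((m : ℝ) * w + 1) * (n : ℝ) + 1) ≤
        Real.log ((m : ℝ) * w + 2) + Real.log n := by
      rw [← Real.log_mul (by positivity) (by positivity)]
      exact Real.log_le_log (by positivity) (by linarith)
    have h5 : 2 * w + 4 * w * Real.log ((m : ℝ) * w + 2) ≤ (n : ℝ) * ε := (div_le_iff₀ hε).mp hn2
    have h6 : 2 * w * Real.log (((m : ℝ) * w + 1) * (n : ℝ) + 1) ≤
        2 * w * (Real.log ((m : ℝ) * w + 2) + Real.log n) :=
      mul_le_mul_of_nonneg_left h4 (by positivity)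
    linarith
  -- (2) the main estimate, for `n ≥ 1` with (1)
  filter_upwards [hlog, eventually_ge_atTop 1] with n hn hn1
  have hn0 : (1 : ℝ) ≤ n := by exact_mod_cast hn1
  have hwn : (1 : ℝ) ≤ w * n := one_le_mul_of_one_le_of_one_le hw1 hn0
  have hmwn : (1 : ℝ) ≤ m * w * n :=
    one_le_mul_of_one_le_of_one_le (one_le_mul_of_one_le_of_one_le hm1 hw1) hn0
  -- Stirling from below for `(wn)!`, with `log (wn) = log (mwn) - log m`
  have hA : (w : ℝ) * n * (Real.log (m * w * n) - Real.log m) - w * n ≤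
      Real.log ((w * n).factorial : ℝ) := by
    have h := Stirling.le_log_factorial_stirling (n := w * n) (by positivity)
    push_cast at h
    have h1 : 0 ≤ Real.log (w * n) := Real.log_nonneg hwn
    have h2 : 0 ≤ Real.log (2 * π) := Real.log_nonneg (by linarith [Real.two_le_pi])
    have h3 : Real.log ((w : ℝ) * n) = Real.log (m * w * n) - Real.log m := by
      rw [mul_assoc (m : ℝ), Real.log_mul hm0.ne' (by positivity)]
      ring
    rw [← h3]
    linarith
  -- Stirling from below for `(mwn)!`
  have hA2 : (m : ℝ) * w * n * Real.log (m * w * n) - m * w * n ≤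
      Real.log ((m * w * n).factorial : ℝ) := by
    have h := Stirling.le_log_factorial_stirling (n := m * w * n) (by positivity)
    push_cast at h
    have h1 : 0 ≤ Real.log (m * w * n) := Real.log_nonneg hmwn
    have h2 : 0 ≤ Real.log (2 * π) := Real.log_nonneg (by linarith [Real.two_le_pi])
    linarith
  -- Stirling from above for `((mw+1)n+1)!`
  have hB : Real.log (((m * w + 1) * n + 1).factorial : ℝ) ≤
      ((m * w + 1) * n + 1) * Real.log ((m * w + 1) * n + 1) - ((m * w + 1) * n + 1)
        + Real.log ((m * w + 1) * n + 1) / 2 + 1 := by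
    have h := log_factorial_succ_le ((m * w + 1) * n)
    push_cast at h
    exact h
  -- `log ((mw+1)n+1) - log (mwn) - log ((mw+1)/(mw)) = log (1 + 1/((mw+1)n)) ≤ 1/((mw+1)n)`
  have hkey : Real.log ((m * w + 1) * n + 1) ≤
      Real.log (m * w * n) + Real.log (((m : ℝ) * w + 1) / (m * w)) + 1 / ((m * w + 1) * n) := by
    have h1 : Real.log (((m * w + 1) * n + 1) / ((m * w + 1) * n)) ≤
        ((m * w + 1) * n + 1) / ((m * w + 1) * n) - 1 :=
      Real.log_le_sub_one_of_pos (by positivity)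
    have h2 : Real.log (((m * w + 1) * n + 1) / ((m * w + 1) * n)) =
        Real.log ((m * w + 1) * n + 1)
          - (Real.log (m * w * n) + Real.log (((m : ℝ) * w + 1) / (m * w))) := by
      have e : (m : ℝ) * w * n * ((m * w + 1) / (m * w)) = (m * w + 1) * n := by
        field_simp
      rw [← Real.log_mul (by positivity : (m : ℝ) * w * n ≠ 0)
          (by positivity : ((m : ℝ) * w + 1) / (m * w) ≠ 0), e,
        Real.log_div (by positivity : ((m : ℝ) * w + 1) * n + 1 ≠ 0)
          (by positivity : ((m : ℝ) * w + 1) * n ≠ 0)]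
    have h3 : (((m : ℝ) * w + 1) * n + 1) / ((m * w + 1) * n) - 1 = 1 / ((m * w + 1) * n) := by
      field_simp
      ring
    linarith
  -- multiply by `w (mw+1) n ≥ 0`: the excess `w (mw+1) n / ((mw+1) n) = w` is a constant
  have h6 : (w : ℝ) * (m * w + 1) * n * Real.log ((m * w + 1) * n + 1) ≤
      (w : ℝ) * (m * w + 1) * n * Real.log (m * w * n)
        + (w : ℝ) * (m * w + 1) * n * Real.log (((m : ℝ) * w + 1) / (m * w)) + w := by
    have h := mul_le_mul_of_nonneg_left hkey
      (by positivity : (0 : ℝ) ≤ (w : ℝ) * (m * w + 1) * n)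
    have e : (w : ℝ) * (m * w + 1) * n * (1 / ((m * w + 1) * n)) = w := by
      field_simp
    linarith
  -- weighted Stirling bounds
  have hA2' : (w : ℝ) * (m * w * n * Real.log (m * w * n) - m * w * n) ≤
      w * Real.log ((m * w * n).factorial : ℝ) :=
    mul_le_mul_of_nonneg_left hA2 hw0.le
  have hB' : (w : ℝ) * Real.log (((m * w + 1) * n + 1).factorial : ℝ) ≤
      w * (((m * w + 1) * n + 1) * Real.log ((m * w + 1) * n + 1) - ((m * w + 1) * n + 1)
        + Real.log ((m * w + 1) * n + 1) / 2 + 1) :=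
    mul_le_mul_of_nonneg_left hB hw0.le
  have hlogb : 0 ≤ (w : ℝ) * Real.log ((m * w + 1) * n + 1) :=
    mul_nonneg hw0.le (Real.log_nonneg (le_add_of_nonneg_left (by positivity)))
  -- combine in logarithmic form
  have hR : -(((w : ℝ) * (((m : ℝ) * w + 1) * Real.log (((m : ℝ) * w + 1) / ((m : ℝ) * w))
        - Real.log m) + ε) * n) ≤
      2 * ((w : ℝ) * n) * Real.log m + Real.log ((w * n).factorial : ℝ)
        + w * Real.log ((m * w * n).factorial : ℝ)
        - w * Real.log (((m * w + 1) * n + 1).factorial : ℝ) := by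
    linarith
  have hMpos : (0 : ℝ) < (m : ℝ) ^ (2 * (w * n)) := pow_pos hm0 _
  have hApos : (0 : ℝ) < (w * n).factorial := by exact_mod_cast Nat.factorial_pos _
  have hA2pos : (0 : ℝ) < (m * w * n).factorial := by exact_mod_cast Nat.factorial_pos _
  have hBpos : (0 : ℝ) < ((m * w + 1) * n + 1).factorial := by
    exact_mod_cast Nat.factorial_pos _
  rw [← Real.exp_log (by positivity :
      (0 : ℝ) < (m : ℝ) ^ (2 * (w * n)) * ((w * n).factorial : ℝ) *
        ((m * w * n).factorial : ℝ) ^ w / (((m * w + 1) * n + 1).factorial : ℝ) ^ w),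
    Real.exp_le_exp, Real.log_div (by positivity) (pow_pos hBpos _).ne',
    Real.log_mul (by positivity) (pow_pos hA2pos _).ne',
    Real.log_mul hMpos.ne' hApos.ne', Real.log_pow, Real.log_pow, Real.log_pow]
  push_cast
  linarith

end Literature.NumberTheory.DiophantineApproximation
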